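import Summits.NavierStokesRegularity.NavierStokesRegularity.Theses.PalasekTowerBreakdown
import Summits.NavierStokesRegularity.FluidComputer.PalasekTowerOvershootFirstHitting

/-!
# Route `PalasekTowerBreakdown`: the HAND-OVER SIGNATURE every witness of the child cruxes carries,
# and the first rung from «local continuation ∧ no pressure-push ∧ floors» — by name

Cell `ns-blowup`, seat `ns-blowup-fc-prover-3` (g2; prover). Support file for the child cruxes
`PalasekTowerBreakdown.HeredityAtOne` (item stmt-NavierStokesRegularity-19249) and
`PalasekTowerBreakdown.HeredityFromTwo` (-19250) of the route — SUPPORTS only, nothing claimed or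
closed. LABEL: E–C typing (KERNEL: compositions of this seat's landed FluidComputer theorems
`PalasekTowerStageTightness.lean` p441519 / `PalasekTowerOvershootFirstHitting.lean` with the route
decls BY NAME; no new mathematics, no named fact). WHAT THIS IS NOT: not Navier–Stokes evidence — the
cruxes are OPEN; the statements below are necessary conditions on their witnesses and a reformulation
of one stub, nothing is constructed.

* `palasekTowerBreakdown_heredityAtOne_handover` — ANY proof of `HeredityAtOne` delivers, for every
  pinned rigid quiet wide schedule and every registered level-1 stage, a level-2 extension whose
  hand-over `1 → 2` is force-free and PRESSURE-DRIVEN at its first-hitting instant: some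
  `t⋆ ∈ (τ₁, τ₂]` and a global argmax `x⋆` with `‖u(t⋆, x⋆)‖ = c₁ Y₂`, `‖u‖ < c₁ Y₂` on
  `[0, t⋆) × ℝ³`, speed rising into `t⋆`, and `|Du(t⋆, x⋆)|²_F + ⟪u, ∇p⟫(t⋆, x⋆) ≤ 0`
  (`Stage.exists_window_firstHitting_rigid_quiet`, unconditional).
* `palasekTowerBreakdown_heredityFromTwo_handover` — the same at every hand-over `k → k+1`, `k ≥ 2`,
  for the extensions delivered by `HeredityFromTwo`.
* `palasekTowerBreakdown_heredityAtOne_of_local_noPush_floors` — the first rung BY NAME from three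
  stubs: local continuation across `τ₁` (`LocalContinuationAt 1`, ecbridge-7; conditional on F2 by
  ecbridge-1 g5), the sign condition «no pressure-push at first touchings of the ceiling `c₂ Y₂`»
  (this seat's `aprioriCeilingAt_of_noPush`), and the readout floors (`ReadoutFloorsAt 1`).

References: S. Palasek, arXiv:2605.13827 §4 [cite: Palasek2026ElementaryModel, §4].
-/

-- `Summit.<Summit>.<Problem>` is the tree's mandated summit-side namespace (CONVENTIONS §2); for this
-- single-conjunct summit the two coincide, so the duplicate is deliberate.
set_option linter.dupNamespace false

noncomputable section

namespace Summit.NavierStokesRegularity.NavierStokesRegularity.Theorems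

open Set MeasureTheory Filter Topology Function Real
open scoped ENNReal ContDiff NNReal InnerProductSpace RealInnerProductSpace
open Summit.NavierStokesRegularity.NavierStokesRegularity.Theses
open Summit.NavierStokesRegularity.FluidComputer.PalasekTowerClayBridge
open Literature.Analysis.FluidPDE

/-- **The hand-over signature of every witness of `HeredityAtOne`.** If the child crux holds, then for
every pinned (`Λ = 8`, `θ = 6/5`), rigid, quiet schedule on the wide-base rates and every globally
anchored registered level-1 stage `s` there is a level-2 stage `s'` extending it WHOSE HAND-OVER
`1 → 2` IS PRESSURE-DRIVEN AT ITS FIRST-HITTING INSTANT: `∃ t⋆ ∈ (τ₁, τ₂], ∃ x⋆`,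
`‖s'.u t⋆ x⋆‖ = c₁ Y₂` is the global speed maximum at `t⋆`, `‖s'.u‖ < c₁ Y₂` on `[0, t⋆) × ℝ³`,
`0 ≤ ⟪u, ∂ₜu⟫` and `|Du|²_F + ⟪u, ∇p⟫ ≤ 0` at `(t⋆, x⋆)` (unit viscosity; force silent after `τ₁`).
Unconditional in `s'` (`Stage.exists_window_firstHitting_rigid_quiet`); conditional only on the crux
that produces `s'`. [cite: Palasek2026ElementaryModel, §4] -/
theorem palasekTowerBreakdown_heredityAtOne_handover (h : PalasekTowerBreakdown.HeredityAtOne) :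
    ∀ S : Schedule TowerRates.wide, S.Pins 8 (6 / 5) → S.Rigid → S.Quiet →
      ∀ s : Stage 1 TowerRates.wide S (Margins.routeG TowerRates.wide) 1,
        ∃ s' : Stage 1 TowerRates.wide S (Margins.routeG TowerRates.wide) 2, s.Extends s' ∧
          ∃ t₀ ∈ Ioc (S.τ 1) (S.τ 2), ∃ x₀ : EuclideanSpace ℝ (Fin 3),
            ‖s'.u t₀ x₀‖ = S.c₁ * TowerRates.wide.Y 2 ∧
            (∀ x, ‖s'.u t₀ x‖ ≤ S.c₁ * TowerRates.wide.Y 2) ∧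
            (∀ t ∈ Ico 0 t₀, ∀ x, ‖s'.u t x‖ < S.c₁ * TowerRates.wide.Y 2) ∧
            0 ≤ ⟪s'.u t₀ x₀, timeDerivWithin (Icc 0 (S.τ 2)) s'.u t₀ x₀⟫ ∧
            1 * frobeniusNormSq (fderiv ℝ (s'.u t₀) x₀) + ⟪s'.u t₀ x₀, gradient (s'.p t₀) x₀⟫ ≤ 0 := by
  intro S hP hR hQ s
  obtain ⟨s', hs'⟩ := h S hP hR hQ s
  exact ⟨s', hs', s'.exists_window_firstHitting_rigid_quiet one_pos hR hQ (j := 1) le_rfl le_rfl⟩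

/-- **The hand-over signature of every witness of `HeredityFromTwo`**: for `k ≥ 2`, the level-`(k+1)`
extension delivered by the crux crosses the floor speed `c₁ Y_{k+1}` for the first time at some
`t⋆ ∈ (τ_k, τ_{k+1}]`, at a global argmax where `|Du|²_F + ⟪u, ∇p⟫ ≤ 0`.
[cite: Palasek2026ElementaryModel, §4] -/
theorem palasekTowerBreakdown_heredityFromTwo_handover (h : PalasekTowerBreakdown.HeredityFromTwo) :
    ∀ S : Schedule TowerRates.wide, S.Pins 8 (6 / 5) → S.Rigid → S.Quiet → ∀ k : ℕ, 2 ≤ k →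
      ∀ s : Stage 1 TowerRates.wide S (Margins.routeG TowerRates.wide) k,
        ∃ s' : Stage 1 TowerRates.wide S (Margins.routeG TowerRates.wide) (k + 1), s.Extends s' ∧
          ∃ t₀ ∈ Ioc (S.τ k) (S.τ (k + 1)), ∃ x₀ : EuclideanSpace ℝ (Fin 3),
            ‖s'.u t₀ x₀‖ = S.c₁ * TowerRates.wide.Y (k + 1) ∧
            (∀ x, ‖s'.u t₀ x‖ ≤ S.c₁ * TowerRates.wide.Y (k + 1)) ∧
            (∀ t ∈ Ico 0 t₀, ∀ x, ‖s'.u t x‖ < S.c₁ * TowerRates.wide.Y (k + 1)) ∧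
            0 ≤ ⟪s'.u t₀ x₀, timeDerivWithin (Icc 0 (S.τ (k + 1))) s'.u t₀ x₀⟫ ∧
            1 * frobeniusNormSq (fderiv ℝ (s'.u t₀) x₀) + ⟪s'.u t₀ x₀, gradient (s'.p t₀) x₀⟫ ≤ 0 := by
  intro S hP hR hQ k hk s
  obtain ⟨s', hs'⟩ := h S hP hR hQ k hk s
  exact ⟨s', hs',
    s'.exists_window_firstHitting_rigid_quiet one_pos hR hQ (j := k) (by omega) le_rfl⟩

/-- **THE FIRST RUNG BY NAME FROM «local continuation ∧ no pressure-push ∧ floors».** Item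
stmt-NavierStokesRegularity-19249 `PalasekTowerBreakdown.HeredityAtOne` follows from: (i) local
classical continuation of every registered level-1 stage across `τ₁` (`LocalContinuationAt 1` — a
Literature debt only, ecbridge-1 g5 `localContinuationAt_of_forced_local_existence`); (ii) the SIGN
CONDITION «at every first touching of the next ceiling `c₂ Y₂` by a global speed maximum of a
finite-energy classical continuation of a registered level-1 stage (before `τ₂`), the pressure does not
push: `0 < |Du|²_F + ⟪u, ∇p⟫`» — which gives `AprioriCeilingAt 1` (this seat's
`aprioriCeilingAt_of_noPush`); (iii) the readout floors at `τ₂` (`ReadoutFloorsAt 1`). Composition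
`heredityAtOne_of_local_apriori_floors` (ecbridge-7). The three hypotheses are OPEN; nothing is
asserted. [cite: Palasek2026ElementaryModel, §4] -/
theorem palasekTowerBreakdown_heredityAtOne_of_local_noPush_floors (hL : LocalContinuationAt 1)
    (hNP : ∀ S : Schedule TowerRates.wide, S.Pins 8 (6 / 5) → S.Rigid → S.Quiet →
      ∀ s : Stage 1 TowerRates.wide S (Margins.routeG TowerRates.wide) 1,
      ∀ T' ∈ Icc (S.τ 1) (S.τ (1 + 1)),
      ∀ (u : ℝ → EuclideanSpace ℝ (Fin 3) → EuclideanSpace ℝ (Fin 3))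
        (p : ℝ → EuclideanSpace ℝ (Fin 3) → ℝ),
        IsClassicalNSSolutionOn (Icc 0 T') 1 S.f u p →
        (∀ t ∈ Icc 0 (S.τ 1), u t = s.u t ∧ p t = s.p t) →
        (∃ C : ℝ≥0∞, C < ⊤ ∧ ∀ t ∈ Icc 0 T', ∫⁻ x, ‖u t x‖ₑ ^ 2 ≤ C) →
        ∀ t ∈ Ioc (S.τ 1) T', ∀ x : EuclideanSpace ℝ (Fin 3),
          ‖u t x‖ = S.c₂ * TowerRates.wide.Y (1 + 1) →
          (∀ y, ‖u t y‖ ≤ S.c₂ * TowerRates.wide.Y (1 + 1)) →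
          (∀ t' ∈ Ico 0 t, ∀ y, ‖u t' y‖ < S.c₂ * TowerRates.wide.Y (1 + 1)) →
          0 < frobeniusNormSq (fderiv ℝ (u t) x) + ⟪u t x, gradient (p t) x⟫)
    (hF : ReadoutFloorsAt 1) : PalasekTowerBreakdown.HeredityAtOne :=
  heredityAtOne_of_local_apriori_floors hL (aprioriCeilingAt_of_noPush le_rfl hNP) hF

/-- **`HeredityFromTwo` BY NAME from «no pressure-push ∧ floors» at the generic levels.** Item
stmt-NavierStokesRegularity-19250 `PalasekTowerBreakdown.HeredityFromTwo` (= `HeredityFrom 2`) follows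
from the SIGN CONDITION «at every first touching of the next ceiling `c₂ Y_{k+1}` (`k ≥ 2`) by a global
speed maximum of a finite-energy classical continuation of a registered level-`k` stage, the pressure
does not push: `0 < |Du|²_F + ⟪u, ∇p⟫`» (which gives `AprioriCeiling`, this seat's
`aprioriCeiling_of_noPush`) together with the readout floors `ReadoutFloors` (composition
`heredityFrom_two_of_aprioriCeiling_floors`, ecbridge-5). Both hypotheses are OPEN; nothing is
asserted. [cite: Palasek2026ElementaryModel, §4] -/
theorem palasekTowerBreakdown_heredityFromTwo_of_noPush_floors
    (hNP : ∀ S : Schedule TowerRates.wide, S.Pins 8 (6 / 5) → S.Rigid → S.Quiet → ∀ k : ℕ, 2 ≤ k →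
      ∀ s : Stage 1 TowerRates.wide S (Margins.routeG TowerRates.wide) k,
      ∀ T' ∈ Icc (S.τ k) (S.τ (k + 1)),
      ∀ (u : ℝ → EuclideanSpace ℝ (Fin 3) → EuclideanSpace ℝ (Fin 3))
        (p : ℝ → EuclideanSpace ℝ (Fin 3) → ℝ),
        IsClassicalNSSolutionOn (Icc 0 T') 1 S.f u p →
        (∀ t ∈ Icc 0 (S.τ k), u t = s.u t ∧ p t = s.p t) →
        (∃ C : ℝ≥0∞, C < ⊤ ∧ ∀ t ∈ Icc 0 T', ∫⁻ x, ‖u t x‖ₑ ^ 2 ≤ C) →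
        ∀ t ∈ Ioc (S.τ k) T', ∀ x : EuclideanSpace ℝ (Fin 3),
          ‖u t x‖ = S.c₂ * TowerRates.wide.Y (k + 1) →
          (∀ y, ‖u t y‖ ≤ S.c₂ * TowerRates.wide.Y (k + 1)) →
          (∀ t' ∈ Ico 0 t, ∀ y, ‖u t' y‖ < S.c₂ * TowerRates.wide.Y (k + 1)) →
          0 < frobeniusNormSq (fderiv ℝ (u t) x) + ⟪u t x, gradient (p t) x⟫)
    (hF : ReadoutFloors) : PalasekTowerBreakdown.HeredityFromTwo :=
  heredityFrom_two_of_aprioriCeiling_floors (aprioriCeiling_of_noPush hNP) hF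

end Summit.NavierStokesRegularity.NavierStokesRegularity.Theorems

end
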